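import Literature.AlgebraicGeometry.AbelianSchemes.AbelianSchemeQuotientPoincarePullback
import Literature.AlgebraicGeometry.AbelianSchemes.AbelianSchemeQuotientDualSideAction
import Literature.AlgebraicGeometry.RelativeSpec.EquivariantModuleDescent
import Literature.AlgebraicGeometry.RelativeSpec.EquivariantModuleRankDescent
import Literature.AlgebraicGeometry.Modules.EquivariantStructure
import Literature.AlgebraicGeometry.Modules.RankOneDescentAlongH0Iso
import HarnessLib

/-!
# The dual pair of the quotient `A/K`: the descended Poincaré sheaf and the assembly (HECKE-LINK H2, file (ii) part 2 = D4)

Layer `Literature/AlgebraicGeometry/AbelianSchemes`, namespace `Literature.AlgebraicGeometry.AbelianSchemes.AbelianSchemeOver`.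
Cell `hodgecm-mathlib`, HECKE-LINK line card v1.2 §1 (file (ii) = critical path), census
`B-provers/B-p20/g9/CENSUS-H2-DualPairOfQuotient.B-p20g9.md` §1 step D4, over ★ (ii) part 1 `AbelianSchemeQuotientPoincarePullback`
(p744103: `𝒩₁ = poincarePullback`, the stabiliser `K′_max`), ★ D3a `AbelianSchemeQuotientDualSideAction` (p743959: the
`K′`-translation action `prodTranslationActionOver` on `B ×_S Â` over `B ◁ ψ̂ : B ×_S Â → B ×_S (Â/K′)`, a FREE affine
geometric quotient), ★ T1 `RelativeSpec/EquivariantModuleDescent` (`moduleInvariants`, `isIso_descentHom`) and ★ (β)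
`RelativeSpec/EquivariantModuleRankDescent` (`hasRank_moduleInvariants_of_free`).  [MumfordAV1970] §15 Thm. 1 (p. 143)
(«the dual of `A/C` is `Â/C^⊥`»), §12 Thm. 1 (descent of sheaves along `X → X/G`); [MilneAV2008] I §9.

Given a `K′`-EQUIVARIANT STRUCTURE `Φ` on `𝒩₁ = (π × 1)^*𝒫` for the D3a action (the NORMALISED structure of D3b,
`AbelianSchemeQuotientPoincareEquivariant`, for a finite `K′ ≤ K′_max`; here a DATA BINDER), this file DESCENDS `𝒩₁` along
`B ◁ ψ̂`:
* `poincareQuot Φ := (prodTranslationActionOver …).moduleInvariants 𝒩₁ Φ.iso` — the Poincaré sheaf `𝒫_B` of `B := A/K` on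
  `B ×_S B̂`, `B̂ := Â/K′` (DEFINITION, no choice);
* `isIso_descentHom_poincareQuot` / `poincareQuotIso : (B ◁ ψ̂)^*𝒫_B ≅ 𝒩₁` (★ T1) with its `K′`-equivariance
  `pullback_map_poincareQuotIso_hom_comp`, `isQuasicoherent_poincareQuot`,
  **`hasRank_poincareQuot : HasRank 𝒫_B 1`** (★ (β)) — clause `hasRank_one` of the dual pair is thereby PROVED;
* the ASSEMBLY `dualPairOfQuotient Φ (h2) (h3) (h4) : (A/K).DualPair` with `hat := Â/K′`, `P := 𝒫_B`, and the remaining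
  axioms — rigidification along `e_B × 1` (D5a), fibrewise `Pic⁰` (D5b), UNIVERSALITY (D6) — as RAW hypotheses typed
  exactly as ★ `DualPair`'s fields (each = one follow-up PROOF file; 0 `Prop`-valued def, debt 0).

HC_CM is proved only modulo the 7 printed citations until rung 0 closes; nothing here is about HC.

## References
* [MumfordAV1970] D. Mumford, *Abelian Varieties* (1970), §12 Thm. 1 (p. 112), §15 Thm. 1 (p. 143).
* [MilneAV2008] J. S. Milne, *Abelian Varieties* (2008), I §8–§9 (Thm. 9.1, p. 42).
* [SGA1] A. Grothendieck, *SGA 1*, Exp. VIII Prop. 1.10.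
-/

noncomputable section

universe u

open CategoryTheory CategoryTheory.Limits AlgebraicGeometry MonoidalCategory CartesianMonoidalCategory
open scoped MonObj

namespace Literature.AlgebraicGeometry.AbelianSchemes

namespace AbelianSchemeOver

open Literature.AlgebraicGeometry.RelativeSpec Literature.AlgebraicGeometry.AbelianVarieties
  Literature.AlgebraicGeometry.Motives Literature.AlgebraicGeometry.Modules

variable {S : Scheme.{u}} (A : AbelianSchemeOver S)
  {Y : Scheme.{u}} (u : S ⟶ Y) (K : Subgroup A.Sections) [IsCommMonObj A.X] {n : ℕ}
  (hK : ∀ σ : K, (σ : A.Sections) ^ n = 1)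
  [Finite K] [Y.IsSeparated] [IsSeparated (A.X.hom ≫ u)] [S.IsSeparated]
  (hcov : ∀ x : A.left, ∃ O : (A.translationActionOver u K).StableAffineOpens, x ∈ O.1)
  [LocallyOfFiniteType (A.X.hom ≫ u)] [IsLocallyNoetherian Y]
  (hG : ∃ _ : GrpObj (A.quotientOver u K), IsMonHom (A.quotientMk u K hcov))
  (hsm : Smooth (A.quotientOver u K).hom) (hgc : GeometricallyConnected (A.quotientOver u K).hom)
  (D : A.DualPair) [IsAffine Y]
  (hfree : ∀ (Ω : Type u) [Field Ω] [IsAlgClosed Ω] (x : Spec (.of Ω) ⟶ A.left) (σ : K), σ ≠ 1 →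
    x ≫ (A.translation (σ : A.Sections)).left ≠ x)

/-- `𝒩₁` is quasi-coherent (a line bundle). [cite: MumfordAV1970, §12 Thm. 1 (p. 112)] -/
theorem isQuasicoherent_poincarePullback : (A.poincarePullback u K hK hcov hG hsm hgc D hfree).IsQuasicoherent :=
  isQuasicoherent_of_hasRank (A.poincarePullbackBundle u K hK hcov hG hsm hgc D hfree).hasRank_one

variable
  -- the dual side: a finite subgroup `K′ ≤ Â(S)` with the file-(i) hypotheses for `(Â, K′)`
  (K' : Subgroup D.hat.Sections) [Finite K'] [IsSeparated (D.hat.X.hom ≫ u)]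
  (hcov' : ∀ x : D.hat.left, ∃ O : (D.hat.translationActionOver u K').StableAffineOpens, x ∈ O.1)
  [LocallyOfFiniteType (D.hat.X.hom ≫ u)]
  (hG' : ∃ _ : GrpObj (D.hat.quotientOver u K'), IsMonHom (D.hat.quotientMk u K' hcov'))
  (hsm' : Smooth (D.hat.quotientOver u K').hom) (hgc' : GeometricallyConnected (D.hat.quotientOver u K').hom)
  (hfree' : ∀ (Ω : Type u) [Field Ω] [IsAlgClosed Ω] (x : Spec (.of Ω) ⟶ D.hat.left) (σ : K'), σ ≠ 1 →
    x ≫ (D.hat.translation (σ : D.hat.Sections)).left ≠ x)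
  -- D3b's output: a `K′`-equivariant structure on `𝒩₁` for the D3a action
  (Φ : (prodTranslationActionOver (A.quotientBy u K hcov hG hsm hgc) D.hat u K' hcov').EquivariantStructure
    (A.poincarePullback u K hK hcov hG hsm hgc D hfree))

/-! ### Generic junctions: (T1)/(β) fed with a bundled `EquivariantStructure` (stated for a VARIABLE action `ρ`, so that the
instantiation at `prodTranslationActionOver` below is a syntactic match — pattern of ★ `Motives/AbelianVarietyDualQuotientAction`) -/

section Aux

variable {X Q : Scheme.{u}} {p : X ⟶ Q} {G : Type u} [Group G] [Fintype G] [IsAffineHom p] (ρ : ActionOver p G)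
  (hq : ρ.IsGeometricQuotient p)
  (hfr : ∀ (V : Q.Opens), IsAffineOpen V → ∀ g : G, g ≠ 1 →
    Ideal.span (Set.range fun b : Γ(X, p ⁻¹ᵁ V) ↦ ρ.act g V b - b) = ⊤)
  (E : X.Modules) (Ψ : ρ.EquivariantStructure E)

include hq hfr in
omit [IsCommMonObj A.X] [Finite K] [Y.IsSeparated] [IsSeparated (A.X.hom ≫ u)] [S.IsSeparated]
  [LocallyOfFiniteType (A.X.hom ≫ u)] [IsLocallyNoetherian Y] [IsAffine Y] [Finite K']
  [IsSeparated (D.hat.X.hom ≫ u)] [LocallyOfFiniteType (D.hat.X.hom ≫ u)] in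
/-- (T1) for a bundled equivariant structure: `p^*(p_*E)^G ⟶ E` is an isomorphism. [cite: MumfordAV1970, §12 Thm. 1 (p. 112)] -/
private theorem isIso_descentHom_of_equivariantStructure [E.IsQuasicoherent] : IsIso (ρ.descentHom E Ψ.iso) :=
  ρ.isIso_descentHom E Ψ.iso hq hfr (IsAffineLocalizing.of_isQuasicoherent _) Ψ.iso_one_hom Ψ.iso_mul_hom

include hq hfr in
omit [IsCommMonObj A.X] [Finite K] [Y.IsSeparated] [IsSeparated (A.X.hom ≫ u)] [S.IsSeparated]
  [LocallyOfFiniteType (A.X.hom ≫ u)] [IsLocallyNoetherian Y] [IsAffine Y] [Finite K']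
  [IsSeparated (D.hat.X.hom ≫ u)] [LocallyOfFiniteType (D.hat.X.hom ≫ u)] in
/-- (β) for a bundled equivariant structure: the invariants have the rank of `E`. [cite: MumfordAV1970, §12 Thm. 1 (p. 112)] -/
private theorem hasRank_moduleInvariants_of_equivariantStructure {r : ℕ} (hE : HasRank E r) :
    HasRank (ρ.moduleInvariants E Ψ.iso) r :=
  ρ.hasRank_moduleInvariants_of_free E Ψ.iso hq hfr Ψ.iso_one_hom Ψ.iso_mul_hom hE

end Aux

/-! ## §1 (D4) The descended Poincaré sheaf `𝒫_B` on `B ×_S B̂` -/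

/-- **`𝒫_B`, the Poincaré sheaf of `B := A/K` on `B ×_S (Â/K′)`**: the module of `K′`-INVARIANTS of the direct image of
`𝒩₁ = (π × 1)^*𝒫` along `B ◁ ψ̂` for the equivariant structure `Φ` (★ T1 `moduleInvariants`; a construction, no
choice). [cite: MumfordAV1970, §15 Thm. 1 (p. 143)] [cite: MumfordAV1970, §12 Thm. 1 (p. 112)] -/
def poincareQuot : (((A.quotientBy u K hcov hG hsm hgc).X ⊗ D.hat.quotientOver u K').left).Modules :=
  haveI : Fintype K' := Fintype.ofFinite K'
  (prodTranslationActionOver (A.quotientBy u K hcov hG hsm hgc) D.hat u K' hcov').moduleInvariants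
    (A.poincarePullback u K hK hcov hG hsm hgc D hfree) Φ.iso

omit [LocallyOfFiniteType (D.hat.X.hom ≫ u)] in
include hfree' in
/-- **`(B ◁ ψ̂)^* 𝒫_B ⟶ 𝒩₁` is an isomorphism** (★ T1 `isIso_descentHom`: `B ◁ ψ̂` is a free affine geometric quotient
by D3a, `𝒩₁` is quasi-coherent, `Φ` satisfies the unit and cocycle conditions). [cite: MumfordAV1970, §12 Thm. 1 (p. 112)] -/
theorem isIso_descentHom_poincareQuot :
    haveI : Fintype K' := Fintype.ofFinite K'
    IsIso ((prodTranslationActionOver (A.quotientBy u K hcov hG hsm hgc) D.hat u K' hcov').descentHom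
      (A.poincarePullback u K hK hcov hG hsm hgc D hfree) Φ.iso) := by
  haveI : Fintype K' := Fintype.ofFinite K'
  haveI := isAffineHom_whiskerLeft_quotientMk_left (A.quotientBy u K hcov hG hsm hgc) D.hat u K' hcov'
  haveI := A.isQuasicoherent_poincarePullback u K hK hcov hG hsm hgc D hfree
  exact isIso_descentHom_of_equivariantStructure _
    (isGeometricQuotient_prodTranslationActionOver (A.quotientBy u K hcov hG hsm hgc) D.hat u K' hcov' hfree')
    (prodTranslationActionOver_free (A.quotientBy u K hcov hG hsm hgc) D.hat u K' hcov' hfree') _ Φ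

/-- **`(B ◁ ψ̂)^* 𝒫_B ≅ 𝒩₁`** — the defining isomorphism of the descended Poincaré sheaf (the `ePB` of the assembly).
[cite: MumfordAV1970, §15 Thm. 1 (p. 143)] [cite: MumfordAV1970, §12 Thm. 1 (p. 112)] -/
def poincareQuotIso :
    (Scheme.Modules.pullback ((A.quotientBy u K hcov hG hsm hgc).X ◁ D.hat.quotientMk u K' hcov').left).obj
        (A.poincareQuot u K hK hcov hG hsm hgc D hfree K' hcov' Φ) ≅
      A.poincarePullback u K hK hcov hG hsm hgc D hfree :=
  haveI : Fintype K' := Fintype.ofFinite K'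
  @asIso _ _ _ _ ((prodTranslationActionOver (A.quotientBy u K hcov hG hsm hgc) D.hat u K' hcov').descentHom
    (A.poincarePullback u K hK hcov hG hsm hgc D hfree) Φ.iso)
    (A.isIso_descentHom_poincareQuot u K hK hcov hG hsm hgc D hfree K' hcov' hfree' Φ)

omit [LocallyOfFiniteType (D.hat.X.hom ≫ u)] in
/-- **`(B ◁ ψ̂)^* 𝒫_B ≅ 𝒩₁` intertwines the canonical `K′`-structure of a pull-back with `Φ`** (★ T1
`pullback_map_descentHom_comp`; the `he` input of ★ T2 `descent_unique_of_free` for D5/D6).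
[cite: MumfordAV1970, §12 Thm. 1 (p. 112)] -/
theorem pullback_map_poincareQuotIso_hom_comp (k : K') :
    haveI : Fintype K' := Fintype.ofFinite K'
    (Scheme.Modules.pullback ((prodTranslationActionOver (A.quotientBy u K hcov hG hsm hgc) D.hat u K' hcov').aut k).hom).map
        (A.poincareQuotIso u K hK hcov hG hsm hgc D hfree K' hcov' hfree' Φ).hom ≫ (Φ.iso k).hom =
      ((Scheme.Modules.pullbackComp ((prodTranslationActionOver (A.quotientBy u K hcov hG hsm hgc) D.hat u K' hcov').aut k).hom
          ((A.quotientBy u K hcov hG hsm hgc).X ◁ D.hat.quotientMk u K' hcov').left).app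
            (A.poincareQuot u K hK hcov hG hsm hgc D hfree K' hcov' Φ) ≪≫
        (Scheme.Modules.pullbackCongr
          ((prodTranslationActionOver (A.quotientBy u K hcov hG hsm hgc) D.hat u K' hcov').aut_comp k)).app
            (A.poincareQuot u K hK hcov hG hsm hgc D hfree K' hcov' Φ)).hom ≫
        (A.poincareQuotIso u K hK hcov hG hsm hgc D hfree K' hcov' hfree' Φ).hom := by
  haveI : Fintype K' := Fintype.ofFinite K'
  exact (prodTranslationActionOver (A.quotientBy u K hcov hG hsm hgc) D.hat u K' hcov').pullback_map_descentHom_comp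
    (A.poincarePullback u K hK hcov hG hsm hgc D hfree) Φ.iso k

omit [LocallyOfFiniteType (D.hat.X.hom ≫ u)] in
include hfree' in
/-- **`𝒫_B` is a line bundle** (`HasRank 𝒫_B 1`): rank descends along the free quotient `B ◁ ψ̂` (★ (β)
`hasRank_moduleInvariants_of_free`) — clause `hasRank_one` of the dual pair of `A/K`, PROVED.
[cite: MumfordAV1970, §12 Thm. 1 (p. 112)] [cite: SGA1, Exp. VIII Prop. 1.10] -/
theorem hasRank_poincareQuot : HasRank (A.poincareQuot u K hK hcov hG hsm hgc D hfree K' hcov' Φ) 1 := by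
  haveI : Fintype K' := Fintype.ofFinite K'
  haveI := isAffineHom_whiskerLeft_quotientMk_left (A.quotientBy u K hcov hG hsm hgc) D.hat u K' hcov'
  exact hasRank_moduleInvariants_of_equivariantStructure _
    (isGeometricQuotient_prodTranslationActionOver (A.quotientBy u K hcov hG hsm hgc) D.hat u K' hcov' hfree')
    (prodTranslationActionOver_free (A.quotientBy u K hcov hG hsm hgc) D.hat u K' hcov' hfree') _ Φ
    (A.poincarePullbackBundle u K hK hcov hG hsm hgc D hfree).hasRank_one

omit [LocallyOfFiniteType (D.hat.X.hom ≫ u)] in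
include hfree' in
/-- `𝒫_B` is quasi-coherent. [cite: MumfordAV1970, §12 Thm. 1 (p. 112)] -/
theorem isQuasicoherent_poincareQuot : (A.poincareQuot u K hK hcov hG hsm hgc D hfree K' hcov' Φ).IsQuasicoherent :=
  isQuasicoherent_of_hasRank (A.hasRank_poincareQuot u K hK hcov hG hsm hgc D hfree K' hcov' hfree' Φ)

/-! ## §2 (D5/D6) The assembly of the dual pair of `A/K`, remaining axioms as RAW hypotheses -/

/-- **THE DUAL PAIR OF `A/K`** (assembly): `hat := Â/K′` (★ file (i) applied to `(Â, K′)`), `P := 𝒫_B` (§1), `hasRank_one`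
PROVED (§1); the rigidification of `𝒫_B` along `e_B × 1` (D5a), the fibrewise-`Pic⁰` property (D5b) and the UNIVERSAL
property over all `T → S` (D6, the L–XL theorem: pull a family on `B_T` back to `A_T` along `ψ_T`, classify by `D`,
show the classifying map factors through `Â → Â/K′`, descend the isomorphism) are RAW hypotheses typed exactly as ★
`DualPair`'s fields — each is ONE follow-up PROOF file. [cite: MumfordAV1970, §15 Thm. 1 (p. 143)]
[cite: MilneAV2008, I §9 Thm. 9.1 (p. 42)] -/
def dualPairOfQuotient
    (h2 : Nonempty ((Scheme.Modules.pullback ((A.quotientBy u K hcov hG hsm hgc).unitSlice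
      (D.hat.quotientBy u K' hcov' hG' hsm' hgc'))).obj (A.poincareQuot u K hK hcov hG hsm hgc D hfree K' hcov' Φ) ≅
        SheafOfModules.unit _))
    (h3 : ∀ (Ω : Type u) [Field Ω] [IsAlgClosed Ω] (b : Spec (.of Ω) ⟶ (D.hat.quotientBy u K' hcov' hG' hsm' hgc').X.left),
      IsHomogeneous ((A.quotientBy u K hcov hG hsm hgc).fibre (b ≫ (D.hat.quotientBy u K' hcov' hG' hsm' hgc').X.hom)).toAbelianVariety
        ((Scheme.Modules.pullback ((A.quotientBy u K hcov hG hsm hgc).fibreSlice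
          (D.hat.quotientBy u K' hcov' hG' hsm' hgc') b)).obj (A.poincareQuot u K hK hcov hG hsm hgc D hfree K' hcov' Φ)))
    (h4 : ∀ {T : Scheme.{u}} (f : T ⟶ S) (ℒ : (A.quotientBy u K hcov hG hsm hgc).RigidifiedLineBundle f),
      ℒ.FibrewisePicZero →
      ∃! g : {g : T ⟶ (D.hat.quotientBy u K' hcov' hG' hsm' hgc').X.left //
          g ≫ (D.hat.quotientBy u K' hcov' hG' hsm' hgc').X.hom = f},
        Nonempty ((Scheme.Modules.pullback ((A.quotientBy u K hcov hG hsm hgc).baseChangeToProd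
          (D.hat.quotientBy u K' hcov' hG' hsm' hgc') f g.1 g.2)).obj
            (A.poincareQuot u K hK hcov hG hsm hgc D hfree K' hcov' Φ) ≅ ℒ.L)) :
    (A.quotientBy u K hcov hG hsm hgc).DualPair where
  hat := D.hat.quotientBy u K' hcov' hG' hsm' hgc'
  P := A.poincareQuot u K hK hcov hG hsm hgc D hfree K' hcov' Φ
  hasRank_one := A.hasRank_poincareQuot u K hK hcov hG hsm hgc D hfree K' hcov' hfree' Φ
  rigid := h2
  fibrewisePicZero := h3
  universal := h4

/-- The dual of `A/K` so assembled is `Â/K′`. [cite: MumfordAV1970, §15 Thm. 1 (p. 143)] -/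
theorem dualPairOfQuotient_hat (h2) (h3) (h4) :
    (A.dualPairOfQuotient u K hK hcov hG hsm hgc D hfree K' hcov' hG' hsm' hgc' hfree' Φ h2 h3 h4).hat =
      D.hat.quotientBy u K' hcov' hG' hsm' hgc' := rfl

/-- Its Poincaré sheaf is `𝒫_B = poincareQuot`. [cite: MumfordAV1970, §15 Thm. 1 (p. 143)] -/
theorem dualPairOfQuotient_P (h2) (h3) (h4) :
    (A.dualPairOfQuotient u K hK hcov hG hsm hgc D hfree K' hcov' hG' hsm' hgc' hfree' Φ h2 h3 h4).P =
      A.poincareQuot u K hK hcov hG hsm hgc D hfree K' hcov' Φ := rfl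

end AbelianSchemeOver

end Literature.AlgebraicGeometry.AbelianSchemes

end
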